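import Summits.QuantumFields.YangMills.Theorems.BalabanUVNodesN15FullPropagatorByPartsNode
import HarnessLib

/-!
# THE BY-PARTS CARRIER SLIMMED: the translated-fit and coarse-oscillation clauses of `coeffBgBP` are lattice-Taylor CONSEQUENCES — `NE2PlusOperator` BY NAME for the
# full propagator over the 7-letter (3.35)–(3.36)-shaped carrier (dag-n15-c g8, FILE 9; Track-A node N15 = NE2, s1 «background-layer OPERATOR ingredient»)

`--kind proof --supports stmt-QuantumFields-20544 --as helper` (K3⁷; count-neutral).  Imports BY NAME this seat's FILE 8 `…N15FullPropagatorByPartsNode`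
(`fgInstance`, `fgFamily`, `ne2PlusOperator_fullG_byParts`) and through it FILE 7a (`coeffBgBP`, `bgPairingBP`, `bgInstanceBP`, `bgOpsBP`, `bgFamilyBP`), FILE 6
(`osc_of_fgrad`), this lineage's g3 `…N15BackwardShift` (`VectorPiece.kingPrV_sub`), `T4EtaRateCoeffDefect` (`FibreOsc`, `blockAvg`, `fit_blockAvg`).

WHAT.  FILE 7a's carrier `coeffBgBP` displays NINE regularity clauses on a first-order coefficient family `U = (c′, a′_μ)`; two of them are REDUNDANT:
(I) the coarse one-step oscillation `|ā_μ(x) − ā_μ(x − e_μ)| ≤ cMα₀θ` follows from the coarse gradient clause `|∇_μā_μ| ≤ cMα₀` (`osc_of_fgrad`: `≤ cMα₀∕n`) as soon as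
`n⁻¹ ≤ θ`; (G) the translated fit `|a′_μ(x′ − e′_μ) − ā_μ(πx′ − e_μ)| ≤ 2cMα₀θ` follows from the block oscillation (`fit_blockAvg`) plus (I), because the block of
`x′ − e′_μ` is either the block of `x′` or its `μ`-predecessor (g3 `kingPrV_sub`, here as the abstract hypothesis `hstep`).  §1 defines the SLIM carrier `coeffBgSlim` (the
seven remaining clauses: values, block oscillations, coarse∕fine gradients, and the ONE two-grid derivative-fit letter `|∇′_μa′_μ(x′ − e′_μ) − ∇_μā_μ(πx′ − e_μ)| ≤ cMα₀θ` —
(3.36)'s second-difference content in fit form) and proves `reg_BP_of_slim : Slim.Reg c ⇒ BP.Reg (2c)`; §2 the pairing ∕ instance ∕ kernel family over the slim carrier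
(same entry operators `bgOpsBP`); §3 the torus instance `fgInstanceSlim` ∕ `fgFamilySlim` and the transfer `ne2PlusOperator_fullG_slim_of_BP` (the rate inequality is
literally the same predicate; only the admitted backgrounds grow); §4 ★★★ `ne2PlusOperator_fullG_slim`: `NE2PlusOperator c₃₅ (fgInstanceSlim d hL γ) (fgFamilySlim d hL b γ)`,
`γ = 1∕(8(d+1))`, HYPOTHESIS-FREE (FILE 8 §4 at `2c₃₅`).

HONEST FRAMING.  Bookkeeping de-modelling only: two displayed hypotheses of the background species become theorems; the species is still MODEL-LEVEL (abelianised
first-order coefficients `V′₁` of (3.52), block-averaged coarse partner, the derivative fit consumed as a letter rather than derived from `|∇′∇′a′|`); GENUINE in the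
propagator.  NE2⁺ as printed NOT PRINTED; N15 not discharged; nothing continuum ∕ OS ∕ mass-gap ∕ Clay.
-/

noncomputable section

open scoped BigOperators
open Finset

namespace Summit.QuantumFields.YangMills.BalabanUVNodes.N15.BackgroundLayer

open Literature.MathematicalPhysics.QuantumFieldTheory.Balaban1983to89
open Literature.MathematicalPhysics.QuantumFieldTheory.Balaban1983to89.T4EtaRate (PairedInstance EtaPairing EtaRateIneq342 NE2PlusOperator)
open Literature.MathematicalPhysics.QuantumFieldTheory.Balaban1983to89.T4EtaRateCoeffDefect (pull FibreOsc blockAvg fit_blockAvg)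
open Literature.MathematicalPhysics.QuantumFieldTheory.Balaban1983to89.B5Prop11Plancherel (Tor fine unitVec)
open Literature.MathematicalPhysics.QuantumFieldTheory.Balaban1983to89.B5SiteBridgeP12 (MP)
open Literature.MathematicalPhysics.QuantumFieldTheory.Balaban1983to89.B6UnitTorusCarrier (unitTorusGeo)
open Summit.QuantumFields.YangMills.BalabanUVNodes.N15.OperatorReadout (opGeo opFamily)
open Summit.QuantumFields.YangMills.BalabanUVNodes.N15.TwoGrid (gOp symbOp sLap TGIndex TGIndex.Mn)
open Summit.QuantumFields.YangMills.BalabanUVNodes.N15.VectorPiece (blkFine kingPrV kingPrV_sub bshiftEquiv bshiftEquiv_apply bshiftEquiv_symm_apply)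

variable {d : ℕ}

/-! ## §1 The slim carrier and the lattice-Taylor implication -/

section Carrier

variable {X X' : Type} (J : Type) [Fintype X'] [DecidableEq X]

/-- THE SLIM BY-PARTS CARRIER: FILE 7a's `coeffBgBP` with the two lattice-Taylor consequences (translated fit, coarse one-step oscillation) REMOVED from the displayed
regularity predicate.  The SEVEN (3.35)–(3.36)-shaped letters on a first-order coefficient family `U = (c′, a′_μ)` over a two-grid pair `π : X′ → X` with translations
`τ′_μ` (fine, difference quotients at `n′`) and `τ_μ` (coarse, at `n`): values `|c′|, |a′_μ| ≤ cMα₀`; block oscillations `≤ cMα₀θ`; coarse and fine gradients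
`|∇_μā_μ|, |∇′_μa′_μ| ≤ cMα₀` (`ā = blockAvg π a′`); and the ONE two-grid derivative-fit letter `|∇′_μa′_μ(x′ − e′_μ) − ∇_μā_μ(πx′ − e_μ)| ≤ cMα₀θ` (both slots; no
complexification clauses). [cite: Balaban1985BackgroundPropagators, (3.35)–(3.36) p.396 (shape)] -/
def coeffBgSlim (π : X' → X) (τ : J → X ≃ X) (τ' : J → X' ≃ X') (n n' M θ : ℝ) : B9.Backgrounds where
  Cfg := (X' → ℝ) × (J → X' → ℝ)
  one := 0
  mul := fun U₁ U₂ => U₁ + U₂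
  Reg335 := fun c α₀ U =>
    (((∀ x', |U.1 x'| ≤ c * M * α₀) ∧ ∀ μ x', |U.2 μ x'| ≤ c * M * α₀) ∧
      (FibreOsc π U.1 (fun _ => c * M * α₀ * θ) ∧ ∀ μ, FibreOsc π (U.2 μ) (fun _ => c * M * α₀ * θ))) ∧
    ((∀ μ x, |fgrad n (τ μ) (blockAvg π (U.2 μ)) x| ≤ c * M * α₀) ∧ (∀ μ x', |fgrad n' (τ' μ) (U.2 μ) x'| ≤ c * M * α₀) ∧
      ∀ μ x', |fgrad n' (τ' μ) (U.2 μ) ((τ' μ).symm x') - fgrad n (τ μ) (blockAvg π (U.2 μ)) ((τ μ).symm (π x'))| ≤ c * M * α₀ * θ)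
  Reg336 := fun c α₀ U =>
    (((∀ x', |U.1 x'| ≤ c * M * α₀) ∧ ∀ μ x', |U.2 μ x'| ≤ c * M * α₀) ∧
      (FibreOsc π U.1 (fun _ => c * M * α₀ * θ) ∧ ∀ μ, FibreOsc π (U.2 μ) (fun _ => c * M * α₀ * θ))) ∧
    ((∀ μ x, |fgrad n (τ μ) (blockAvg π (U.2 μ)) x| ≤ c * M * α₀) ∧ (∀ μ x', |fgrad n' (τ' μ) (U.2 μ) x'| ≤ c * M * α₀) ∧
      ∀ μ x', |fgrad n' (τ' μ) (U.2 μ) ((τ' μ).symm x') - fgrad n (τ μ) (blockAvg π (U.2 μ)) ((τ μ).symm (π x'))| ≤ c * M * α₀ * θ)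
  Cplx337 := fun _ _ _ => True
  Cplx338 := fun _ _ _ => True

variable {J}

/-- (I) DERIVED: the coarse one-step oscillation from the coarse gradient clause — `|ā(x) − ā(x − e_μ)| ≤ cMα₀∕n ≤ cMα₀θ` for `n⁻¹ ≤ θ`. [folklore] -/
theorem coarseOsc_of_grad {π : X' → X} {τ : J → X ≃ X} {n M θ c α₀ : ℝ} {a' : J → X' → ℝ} (hn : 0 < n) (hθn : n⁻¹ ≤ θ) (hc : 0 ≤ c * M * α₀)
    (hE : ∀ μ x, |fgrad n (τ μ) (blockAvg π (a' μ)) x| ≤ c * M * α₀) (μ : J) (x : X) :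
    |blockAvg π (a' μ) x - blockAvg π (a' μ) ((τ μ).symm x)| ≤ c * M * α₀ * θ := by
  have h1 := osc_of_fgrad (τ := τ) (a := fun μ => blockAvg π (a' μ)) μ hn (hE μ) x
  calc |blockAvg π (a' μ) x - blockAvg π (a' μ) ((τ μ).symm x)| ≤ c * M * α₀ / n := h1
    _ = c * M * α₀ * n⁻¹ := div_eq_mul_inv _ _
    _ ≤ c * M * α₀ * θ := mul_le_mul_of_nonneg_left hθn hc

/-- (G) DERIVED: the translated fit from the block oscillation and (I) — the block of `x′ − e′_μ` is the block of `x′` or its `μ`-predecessor (`hstep`).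
[folklore] -/
theorem translatedFit_of_osc {π : X' → X} {τ : J → X ≃ X} {τ' : J → X' ≃ X'} {n M θ c α₀ : ℝ} {a' : J → X' → ℝ} (hn : 0 < n) (hθn : n⁻¹ ≤ θ)
    (hc : 0 ≤ c * M * α₀) (hstep : ∀ μ x', π ((τ' μ).symm x') = π x' ∨ π ((τ' μ).symm x') = (τ μ).symm (π x'))
    (hD : ∀ μ, FibreOsc π (a' μ) (fun _ => c * M * α₀ * θ)) (hE : ∀ μ x, |fgrad n (τ μ) (blockAvg π (a' μ)) x| ≤ c * M * α₀) (μ : J) (x' : X') :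
    |a' μ ((τ' μ).symm x') - blockAvg π (a' μ) ((τ μ).symm (π x'))| ≤ 2 * c * M * α₀ * θ := by
  have hfit := fit_blockAvg π (hD μ) ((τ' μ).symm x')
  have hθ : 0 ≤ θ := (inv_pos.mpr hn).le.trans hθn
  have hcθ : 0 ≤ c * M * α₀ * θ := mul_nonneg hc hθ
  rcases hstep μ x' with h | h
  · have hI := coarseOsc_of_grad hn hθn hc hE μ (π x')
    rw [h] at hfit
    calc |a' μ ((τ' μ).symm x') - blockAvg π (a' μ) ((τ μ).symm (π x'))|
        ≤ |a' μ ((τ' μ).symm x') - blockAvg π (a' μ) (π x')| + |blockAvg π (a' μ) (π x') - blockAvg π (a' μ) ((τ μ).symm (π x'))| :=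
          abs_sub_le _ _ _
      _ ≤ c * M * α₀ * θ + c * M * α₀ * θ := add_le_add hfit hI
      _ = 2 * c * M * α₀ * θ := by ring
  · rw [h] at hfit
    exact hfit.trans (by nlinarith)

/-- ★ **SLIM ⇒ BP AT TWICE THE CONSTANT**: the seven (3.35)–(3.36)-shaped letters at level `c` give all nine clauses of FILE 7a's `coeffBgBP` at level `2c`
(`n > 0`, `n⁻¹ ≤ θ`, `cMα₀ ≥ 0`, two-grid step property `hstep`). [folklore] -/
theorem reg_BP_of_slim {π : X' → X} {τ : J → X ≃ X} {τ' : J → X' ≃ X'} {n n' M θ c α₀ : ℝ} {U : (X' → ℝ) × (J → X' → ℝ)} (hn : 0 < n) (hθn : n⁻¹ ≤ θ)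
    (hc : 0 ≤ c * M * α₀) (hstep : ∀ μ x', π ((τ' μ).symm x') = π x' ∨ π ((τ' μ).symm x') = (τ μ).symm (π x'))
    (h : (coeffBgSlim J π τ τ' n n' M θ).Reg335 c α₀ U) : (coeffBgBP J π τ τ' n n' M θ).Reg335 (2 * c) α₀ U := by
  obtain ⟨⟨⟨hA, hB⟩, hC, hD⟩, hE, hF, hH⟩ := h
  have hθ : 0 ≤ θ := (inv_pos.mpr hn).le.trans hθn
  have h2 : c * M * α₀ ≤ 2 * c * M * α₀ := by nlinarith
  have h2θ : c * M * α₀ * θ ≤ 2 * c * M * α₀ * θ := by nlinarith [mul_nonneg hc hθ]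
  exact ⟨⟨⟨fun x' => (hA x').trans h2, fun μ x' => (hB μ x').trans h2⟩, hC.mono fun _ => h2θ, fun μ => (hD μ).mono fun _ => h2θ⟩,
    fun μ x => (hE μ x).trans h2, fun μ x' => (hF μ x').trans h2, translatedFit_of_osc hn hθn hc hstep hD hE,
    fun μ x' => (hH μ x').trans h2θ, fun μ x => (coarseOsc_of_grad hn hθn hc hE μ x).trans h2θ⟩

/-- The same implication into the (3.36) slot of `coeffBgBP` (identical clauses). [folklore] -/
theorem reg336_BP_of_slim {π : X' → X} {τ : J → X ≃ X} {τ' : J → X' ≃ X'} {n n' M θ c α₀ : ℝ} {U : (X' → ℝ) × (J → X' → ℝ)} (hn : 0 < n) (hθn : n⁻¹ ≤ θ)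
    (hc : 0 ≤ c * M * α₀) (hstep : ∀ μ x', π ((τ' μ).symm x') = π x' ∨ π ((τ' μ).symm x') = (τ μ).symm (π x'))
    (h : (coeffBgSlim J π τ τ' n n' M θ).Reg336 c α₀ U) : (coeffBgBP J π τ τ' n n' M θ).Reg336 (2 * c) α₀ U :=
  reg_BP_of_slim hn hθn hc hstep h

/-- Conversely BP at level `c` contains Slim at level `c` (forgetting two clauses). [folklore] -/
theorem slim_of_reg_BP {π : X' → X} {τ : J → X ≃ X} {τ' : J → X' ≃ X'} {n n' M θ c α₀ : ℝ} {U : (X' → ℝ) × (J → X' → ℝ)}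
    (h : (coeffBgBP J π τ τ' n n' M θ).Reg335 c α₀ U) : (coeffBgSlim J π τ τ' n n' M θ).Reg335 c α₀ U :=
  ⟨h.1, h.2.1, h.2.2.1, h.2.2.2.2.1⟩

variable (J) {g : B6.Geometry} [Fintype X]

/-- THE η-PAIRING over the slim fine carrier (coarse partner: FILE 7a's coarse carrier, unchanged) — NOT PRINTED data, as `bgPairingBP`. [cite: King1986, p.664 (convention before Prop. 3.8)] -/
def bgPairingSlim (blk : X → g.Site) (π : X' → X) (τ : J → X ≃ X) (τ' : J → X' ≃ X') (n n' : ℝ) (m : ℕ) (hL : g.L ≠ 0) (θc θ : ℝ) :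
    EtaPairing (opGeo g X blk) (fineGeo g X' (blk ∘ π) m) (coeffBgBP J (fun x : X => x) τ τ n n g.M θc) (coeffBgSlim J π τ τ' n n' g.M θ) where
  n := m
  k_eq := rfl
  L_eq := rfl
  M_eq := rfl
  eta_eq := (bgPairingBP J blk π τ τ' n n' m hL θc θ).eta_eq
  ι := fun y => y
  scale_ι := fun _ => rfl
  dist_ι := fun _ _ => rfl
  τ := fun lam => pull π lam
  suppIn_τ := fun _ _ h x' hx' => h (π x') hx'
  supNorm_τ := (bgPairingBP J blk π τ τ' n n' m hL θc θ).supNorm_τ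
  avg := avg₁ J π
  avg_one := avg₁_zero J π

/-- THE REALISED PAIRED INSTANCE of the by-parts layer over the SLIM fine carrier. [cite: Balaban1985BackgroundPropagators, Thm 3.14 pp.426–427 (typing template)] -/
def bgInstanceSlim (blk : X → g.Site) (π : X' → X) (τ : J → X ≃ X) (τ' : J → X' ≃ X') (n n' : ℝ) (m : ℕ) (hL : g.L ≠ 0) (θc θ : ℝ) : PairedInstance :=
  ⟨opGeo g X blk, fineGeo g X' (blk ∘ π) m, coeffBgBP J (fun x : X => x) τ τ n n g.M θc, coeffBgSlim J π τ τ' n n' g.M θ,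
    bgPairingSlim J blk π τ τ' n n' m hL θc θ⟩

/-- THE GUARD IS LIVE: the fine geometry's size parameter is the datum's `M`. [folklore] -/
theorem bgInstanceSlim_M (blk : X → g.Site) (π : X' → X) (τ : J → X ≃ X) (τ' : J → X' ≃ X') (n n' : ℝ) (m : ℕ) (hL : g.L ≠ 0) (θc θ : ℝ) :
    (bgInstanceSlim J blk π τ τ' n n' m hL θc θ).gf.M = g.M := rfl

end Carrier

/-! ## §2 The kernel family over the slim carrier (same four entry operators `bgOpsBP`) -/

section Ops

variable {X X' J : Type} [Fintype X] [Fintype X'] [Fintype J] [DecidableEq X] [DecidableEq X'] [DecidableEq J] {g : B6.Geometry}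
  (blk : X → g.Site) (π : X' → X)

/-- THE KERNEL FAMILY over the slim carrier: FILE 7a's four entry operators (entry 2 by parts) read through the block norms. [cite: Balaban1985BackgroundPropagators, (3.42) p.397 (shape)] -/
def bgFamilySlim (τ : J → X ≃ X) (τ' : J → X' ≃ X') (n n' : ℝ) (m : ℕ) (hL : g.L ≠ 0) (θc θ : ℝ) (ν : J) (G D₃ : (X → ℝ) →ₗ[ℝ] (X → ℝ))
    (D : J → (X → ℝ) →ₗ[ℝ] (X → ℝ)) (G' D₃' : (X' → ℝ) →ₗ[ℝ] (X' → ℝ)) (D' : J → (X' → ℝ) →ₗ[ℝ] (X' → ℝ)) :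
    B9.KernelFamily (bgInstanceSlim J blk π τ τ' n n' m hL θc θ).gc (bgInstanceSlim J blk π τ τ' n n' m hL θc θ).Bf :=
  show B9.KernelFamily (opGeo g X blk) (coeffBgSlim J π τ τ' n n' g.M θ) from
    opFamily (g := g) (B := coeffBgSlim J π τ τ' n n' g.M θ) blk (blk ∘ π) (bgOpsBP π τ τ' n n' ν G D₃ D G' D₃' D')

/-- THE RATE INEQUALITY IS THE SAME PREDICATE over both carriers (same geometry, same entry operators). [folklore] -/
theorem etaRateIneq342_slim_iff (τ : J → X ≃ X) (τ' : J → X' ≃ X') (n n' : ℝ) (m : ℕ) (hL : g.L ≠ 0) (θc θ : ℝ) (ν : J)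
    (G D₃ : (X → ℝ) →ₗ[ℝ] (X → ℝ)) (D : J → (X → ℝ) →ₗ[ℝ] (X → ℝ)) (G' D₃' : (X' → ℝ) →ₗ[ℝ] (X' → ℝ)) (D' : J → (X' → ℝ) →ₗ[ℝ] (X' → ℝ))
    (B₀ δ₀ γ : ℝ) (U : (X' → ℝ) × (J → X' → ℝ)) :
    EtaRateIneq342 (bgFamilySlim blk π τ τ' n n' m hL θc θ ν G D₃ D G' D₃' D') B₀ δ₀ γ U ↔
      EtaRateIneq342 (bgFamilyBP blk π τ τ' n n' m hL θc θ ν G D₃ D G' D₃' D') B₀ δ₀ γ U :=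
  Iff.rfl

end Ops

/-! ## §3 The torus instance over the slim carrier and the transfer from FILE 8 -/

section Torus

variable {L : ℕ} [NeZero L]

variable (d)

/-- THE REALISED PAIRED INSTANCE at an index `(i, ν)` of the torus family of record, rate exponent `γ`, over the SLIM carrier (FILE 8's `fgInstance` with `coeffBgSlim`
in the fine slot). [cite: Balaban1985BackgroundPropagators, Thm 3.14 pp.426–427 (typing template)] -/
def fgInstanceSlim (hL : Odd L ∧ 1 < L) (γ : ℝ) (i : TGIndex × Fin (d + 1)) : PairedInstance :=
  bgInstanceSlim (Fin (d + 1)) (g := unitTorusGeo L i.1.k (TGIndex.Mn d hL i.1)) (blkFine L i.1.k (TGIndex.Mn d hL i.1)) (kingPrV L i.1.k i.1.m (TGIndex.Mn d hL i.1))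
    (fun μ => bshiftEquiv (TGIndex.Mn d hL i.1) (L ^ i.1.k) μ) (fun μ => bshiftEquiv (TGIndex.Mn d hL i.1) (L ^ i.1.m * L ^ i.1.k) μ) ((L ^ i.1.k : ℕ) : ℝ)
    ((L ^ i.1.m * L ^ i.1.k : ℕ) : ℝ) i.1.m (Nat.cast_ne_zero.mpr (NeZero.ne L)) (((L : ℝ) ^ i.1.k) ^ (-γ)) (((L : ℝ) ^ i.1.k) ^ (-γ))

/-- THE REALISED BY-PARTS KERNEL FAMILY at `(i, ν)` over the slim carrier (same operators as FILE 8's `fgFamily`: `G = gOp`, `D_μ = ∇_μG`, `D₃ = ΔG` at both spacings).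
[cite: Balaban1985BackgroundPropagators, (3.42) p.397 (shape)] -/
def fgFamilySlim (hL : Odd L ∧ 1 < L) (b γ : ℝ) (i : TGIndex × Fin (d + 1)) : B9.KernelFamily (fgInstanceSlim d hL γ i).gc (fgInstanceSlim d hL γ i).Bf :=
  bgFamilySlim (J := Fin (d + 1)) (g := unitTorusGeo L i.1.k (TGIndex.Mn d hL i.1)) (blkFine L i.1.k (TGIndex.Mn d hL i.1)) (kingPrV L i.1.k i.1.m (TGIndex.Mn d hL i.1))
    (fun μ => bshiftEquiv (TGIndex.Mn d hL i.1) (L ^ i.1.k) μ) (fun μ => bshiftEquiv (TGIndex.Mn d hL i.1) (L ^ i.1.m * L ^ i.1.k) μ) ((L ^ i.1.k : ℕ) : ℝ)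
    ((L ^ i.1.m * L ^ i.1.k : ℕ) : ℝ) i.1.m (Nat.cast_ne_zero.mpr (NeZero.ne L)) (((L : ℝ) ^ i.1.k) ^ (-γ)) (((L : ℝ) ^ i.1.k) ^ (-γ)) i.2
    (gOp (TGIndex.Mn d hL i.1) (L ^ i.1.k) b)
    (symbOp (TGIndex.Mn d hL i.1) (L ^ i.1.k) (sLap (TGIndex.Mn d hL i.1) (L ^ i.1.k) ((L ^ i.1.k : ℕ) : ℝ)) ∘ₗ gOp (TGIndex.Mn d hL i.1) (L ^ i.1.k) b)
    (fgD d (TGIndex.Mn d hL i.1) (L ^ i.1.k) b)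
    (gOp (TGIndex.Mn d hL i.1) (L ^ i.1.m * L ^ i.1.k) b)
    (symbOp (TGIndex.Mn d hL i.1) (L ^ i.1.m * L ^ i.1.k) (sLap (TGIndex.Mn d hL i.1) (L ^ i.1.m * L ^ i.1.k) ((L ^ i.1.m * L ^ i.1.k : ℕ) : ℝ)) ∘ₗ
      gOp (TGIndex.Mn d hL i.1) (L ^ i.1.m * L ^ i.1.k) b)
    (fgD d (TGIndex.Mn d hL i.1) (L ^ i.1.m * L ^ i.1.k) b)

variable {d}

omit [NeZero L] in
/-- the rate number dominates the coarse spacing: `(L^k)⁻¹ ≤ (L^k)^{−γ}` for `γ ≤ 1`, `L ≥ 1`. [folklore] -/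
theorem inv_pow_le_rate {k : ℕ} {γ : ℝ} (hL1 : (1 : ℝ) ≤ (L : ℝ)) (hγ1 : γ ≤ 1) : (((L ^ k : ℕ) : ℝ))⁻¹ ≤ ((L : ℝ) ^ k) ^ (-γ) := by
  have hx : (1 : ℝ) ≤ (L : ℝ) ^ k := one_le_pow₀ hL1
  rw [show (((L ^ k : ℕ) : ℝ))⁻¹ = ((L : ℝ) ^ k) ^ (-(1 : ℝ)) by push_cast; rw [Real.rpow_neg_one]]
  exact Real.rpow_le_rpow_of_exponent_le hx (by linarith)

variable (d)

/-- ★★ **TRANSFER**: `NE2PlusOperator (2c₃₅)` for FILE 8's family over `coeffBgBP` gives `NE2PlusOperator c₃₅` over the slim carrier — the rate inequality is the same predicate,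
and every slim-regular background at level `c₃₅` is BP-regular at level `2c₃₅` (`reg_BP_of_slim` with `n = L^k`, `θ = (L^k)^{−γ} ≥ (L^k)⁻¹`, and the step property
`hstep` = this lineage's g3 `VectorPiece.kingPrV_sub` read through `bshiftEquiv_symm_apply` (definitional)).
[cite: Balaban1985BackgroundPropagators, Thm 3.1 p.397 (quantifier template)] -/
theorem ne2PlusOperator_fullG_slim_of_BP (hL : Odd L ∧ 1 < L) {b γ : ℝ} (hγ1 : γ ≤ 1) {c35 : ℝ} (hc35 : 0 ≤ c35)
    (h : NE2PlusOperator (2 * c35) (fgInstance d hL γ) (fgFamily d hL b γ)) : NE2PlusOperator c35 (fgInstanceSlim d hL γ) (fgFamilySlim d hL b γ) := by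
  obtain ⟨M₅, δ₀, a₀, B₀, γ', hM₅, hδ₀, ha₀, hB₀, hγ', H⟩ := h
  refine ⟨M₅, δ₀, a₀, B₀, γ', hM₅, hδ₀, ha₀, hB₀, hγ', fun i hM α₀ hα₀ hMa U hU => ?_⟩
  have hL1 : (1 : ℝ) ≤ (L : ℝ) := by exact_mod_cast hL.2.le
  have hn : (0 : ℝ) < ((L ^ i.1.k : ℕ) : ℝ) := by exact_mod_cast pow_pos (show 0 < L by have := hL.2; omega) _
  have hMpos : 0 < (fgInstance d hL γ i).gf.M := hM₅.trans_le hM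
  have hc : 0 ≤ c35 * (unitTorusGeo L i.1.k (TGIndex.Mn d hL i.1)).M * α₀ := mul_nonneg (mul_nonneg hc35 hMpos.le) hα₀.le
  exact H i hM α₀ hα₀ hMa U (reg_BP_of_slim hn (inv_pow_le_rate hL1 hγ1) hc (fun μ x' => kingPrV_sub (TGIndex.Mn d hL i.1) L i.1.k i.1.m x' μ) hU)

end Torus

/-! ## §4 ★★★ `NE2PlusOperator` BY NAME over the SLIM carrier, hypothesis-free -/

section Free

variable {L : ℕ} [NeZero L]

variable (d)

/-- ★★★ **`T4EtaRate.NE2PlusOperator` BY NAME, NO DISPLAYED BINDER, over the SLIM (3.35)–(3.36)-shaped carrier**: Bałaban's FULL `U ≡ 1` Landau-gauge propagator on the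
torus family of record dressed by a live first-order scalar background whose regularity is the SEVEN slim letters (values, block oscillations, coarse∕fine gradients, one
derivative-fit letter), all four (3.42) entries constructed, entry 2 by parts, rate `γ = 1∕(8(d+1))`, `d ≥ 1` — FILE 8 §4 at `2c₃₅` through the transfer.
MODEL-LEVEL in the background species, GENUINE in the propagator. [cite: Balaban1985BackgroundPropagators, Thm 3.1 p.397 (quantifier template); (3.35)–(3.36) p.396, (3.42) p.397 (shapes)] -/
theorem ne2PlusOperator_fullG_slim (hd1 : 1 ≤ d) (hLodd : Odd L) (hL2 : 2 ≤ L) (hL : Odd L ∧ 1 < L) {b : ℝ} (hb : 0 < b) (c35 : ℝ) (hc35 : 0 < c35) :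
    NE2PlusOperator c35 (fgInstanceSlim d hL (1 / (8 * ((d : ℝ) + 1)))) (fgFamilySlim d hL b (1 / (8 * ((d : ℝ) + 1)))) := by
  have hγ1 : 1 / (8 * ((d : ℝ) + 1)) ≤ 1 := by
    rw [div_le_one (by positivity)]
    have : (0 : ℝ) ≤ d := Nat.cast_nonneg d
    linarith
  exact ne2PlusOperator_fullG_slim_of_BP d hL hγ1 hc35.le (ne2PlusOperator_fullG_byParts d hd1 hLodd hL2 hL hb (2 * c35) (by positivity))

end Free

end Summit.QuantumFields.YangMills.BalabanUVNodes.N15.BackgroundLayer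

end
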